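import Summits.ResolutionOfSingularities.ResolutionOfSingularities.Theorems.HilbertSamuelEliminationSigmaMaxModificationsCorridor3SigmaBoundaryDefs
import HarnessLib

/-!
# [OURS · L1 W4.2] σ-LAYER — `Corridor3SigmaMenuDiscipline`: the GENERIC TYPE of a boundary-reading strategy DISCIPLINED BY A CENTRE MENU, and its scoped
# admissibility (RULINGS v3.14-11c (CT) «build the menu into the oracle's type (centre ∈ menu ∧ regular), so admissibility is by (CS)'s lemma»;
# v3.14-13 (DB): menu of record for the oracle = res-type-067's `IntrinsicMenuPlusAt` — instantiated in the sibling `…Corridor3SigmaMenuStrategy` once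
# 067's `…SigmaMenuDefs` (+ the `IsMenuCentrePlusAt` twin) is in the tree; THIS file is menu-GENERIC and depends only on `…Corridor3SigmaBoundaryDefs`)

Crux chain w42 (`SigmaMaxModifications`, stmt-ResolutionOfSingularities-18506; conjunct `SigmaMaxModificationsCorridor3`, stmt-ResolutionOfSingularities-19249),
σ-layer / ELIMINATION LINE v1 (E2)+(E2′). Typer res-L1-type-o1 (OURS typer G4) over its boundary-threaded state `…Corridor3SigmaBoundaryDefs` (p523041:
`Boundary`, `StrategyE`, `StrategyE.IsFunctional`, `IsAdmissibleStrategyOnE`). OURS (cell res-hironaka, slot W4.2); NOT statements of H. Hironaka's manuscript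
[Hironaka2017] nor of [CossartJannsenSaito2020]; AI-typed, weaker than expert review. Helper VOCABULARY `--supports stmt-ResolutionOfSingularities-19249 --as helper`
(counted 0). Definitions + proved glue; NO row is claimed.

## Contents (namespace `…Theorems.SigmaMaxModificationsCorridor3.Sigma`)

* `CentreMenu` — any predicate `M W E N ν x C` («`C` is an allowed centre at `x` for the boundary `E` at `(N, ν)`»; instances: 067's `IsMenuCentreAt` /
  `IsMenuCentrePlusAt`); `StateScopeE` — a boundary-threaded state scope (as in `IsAdmissibleStrategyOnE`).
* `StrategyE.IsDisciplinedBy M N ν σ` — every step σ allows from `(W, L, P, E)` has an `M`-centre at some point of the `ν`-stratum.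
* `StrategyE.IsDisciplinedByOver M N ν τ σ` — the HYBRID shape of the elimination line: every step of σ is an `M`-step OR a step of the fallback `τ`
  (`(Strategy.cjs R).withBoundary`, res-type-040's Ω / Ω⁺ …).
* `MenuClauseA M N ν 𝒮` — on the scope, `M`-centres at stratum points satisfy clause (a) of admissibility (permissible, inside `X(ν)`, non-empty).
* PROVED: `IsDisciplinedBy.mono`, `.over`, `isDisciplinedByOver_of_step_imp`, `MenuClauseA.mono`, `IsDisciplinedBy.clauseA`,
  **`isAdmissibleStrategyOnE_of_disciplinedBy`**, **`isAdmissibleStrategyOnE_of_disciplinedByOver`** (menu steps by `MenuClauseA`, fallback steps by their own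
  package, + totality on the scope ⇒ `IsAdmissibleStrategyOnE 𝒮 N ν σ`); the restriction `StrategyE.restrictBy M σ` (keep only `M`-steps) with
  `isDisciplinedBy_restrictBy`, `restrictBy_step_imp`, `IsDisciplinedBy.restrictBy_step_iff`, `IsFunctional.restrictBy`.

Why a TYPE and not an instance: the instance ω_ρ (rank-optimal corner rule + service) reads the corner boards `Δ_E(x)`, whose scheme-side dictionary is the open
(E4c)/r-50 object; what the assembly (E6) needs from ANY such instance is «disciplined (over its fallback) + total on the reachable scope ⇒ admissible»,
provided here once and for all, for every menu; §2 gives the POLICY-PARAMETRIC HYBRID `StrategyE.hybrid π τ` (RULING v3.14-13 (DA)): any `M`-disciplined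
policy `π` over any fallback `τ` — disciplined over `τ`, total when `τ` is, functional when both are, hence admissible on good scopes
(`isAdmissibleStrategyOnE_hybrid`).
-/

noncomputable section

set_option linter.dupNamespace false

open CategoryTheory AlgebraicGeometry TopologicalSpace
open Summit.ResolutionOfSingularities.ResolutionOfSingularities.Theorems.CampaignW42
open Literature.AlgebraicGeometry.Resolution Literature.RingTheory.HilbertSamuel

namespace Summit.ResolutionOfSingularities.ResolutionOfSingularities.Theorems.SigmaMaxModificationsCorridor3.Sigma

universe u

/-- [OURS · L1 W4.2] A CENTRE MENU: «`C` is an allowed centre at the point `x` for the boundary `E` at level `N`, value `ν`» (e.g. res-type-067's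
`IsMenuCentreAt` / `IsMenuCentrePlusAt`). [folklore] -/
abbrev CentreMenu : Type (u + 1) :=
  ∀ (W : Scheme.{u}), Boundary W → ℕ → (ℕ → ℕ) → W → W.IdealSheafData → Prop

/-- [OURS · L1 W4.2] A (boundary-threaded) STATE SCOPE, as in `IsAdmissibleStrategyOnE`. [folklore] -/
abbrev StateScopeE : Type (u + 1) :=
  ∀ (W : Scheme.{u}), IsLocallyNoetherian W → Labelling W → Option (Pending W) → Boundary W → Prop

/-! ## §1. Generic: strategies disciplined by a centre menu -/

/-- [OURS · L1 W4.2] **`σ` IS DISCIPLINED BY THE MENU `M` at level `N`, value `ν`**: every step the boundary-reading strategy `σ` allows from a state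
`(W, L, P, E)` has as centre an `M`-centre at some point `x` of the `ν`-stratum. NOT a statement of the manuscript. [folklore] -/
def StrategyE.IsDisciplinedBy (M : CentreMenu.{u}) (N : ℕ) (ν : ℕ → ℕ) (σ : StrategyE.{u}) : Prop :=
  ∀ (W : Scheme.{u}) (hW : IsLocallyNoetherian W) (L : Labelling W) (P : Option (Pending W)) (E : Boundary W)
    (C : W.IdealSheafData) (P' : Option (Pending (blowup C))),
    σ.step W hW N ν L P E C P' → ∃ x ∈ Scheme.hsStratum W N ν, M W E N ν x C

/-- [OURS · L1 W4.2] **DISCIPLINED BY `M` OVER A FALLBACK `τ`** (the HYBRID shape of the ELIMINATION LINE: designed moves are `M`-centres, every other step is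
a step of the fallback strategy `τ` — e.g. `(Strategy.cjs R).withBoundary` or an Ω/Ω⁺ strategy): every step of `σ` is an `M`-step at some stratum point OR a
step `τ` allows from the same state. NOT a statement of the manuscript. [folklore] -/
def StrategyE.IsDisciplinedByOver (M : CentreMenu.{u}) (N : ℕ) (ν : ℕ → ℕ) (τ σ : StrategyE.{u}) : Prop :=
  ∀ (W : Scheme.{u}) (hW : IsLocallyNoetherian W) (L : Labelling W) (P : Option (Pending W)) (E : Boundary W)
    (C : W.IdealSheafData) (P' : Option (Pending (blowup C))),
    σ.step W hW N ν L P E C P' → (∃ x ∈ Scheme.hsStratum W N ν, M W E N ν x C) ∨ τ.step W hW N ν L P E C P'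

/-- [OURS · L1 W4.2] **CLAUSE (a) FOR THE MENU `M` ON THE SCOPE `𝒮`**: at every state of the scope, an `M`-centre at a point of the `ν`-stratum is PERMISSIBLE,
lies INSIDE the `ν`-stratum and is NON-EMPTY while the stratum is (the three conjuncts of clause (a) of `IsAdmissibleStrategyOnE`). For 067's menus on good
scopes this is `menuClauseA_plus` / `menuClauseA_basic` below. [cite: CossartJannsenSaito2020, Def. 3.1, Rem. 6.29 (1)] -/
def MenuClauseA (M : CentreMenu.{u}) (N : ℕ) (ν : ℕ → ℕ) (𝒮 : StateScopeE.{u}) : Prop :=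
  ∀ (W : Scheme.{u}) (hW : IsLocallyNoetherian W) (L : Labelling W) (P : Option (Pending W)) (E : Boundary W), 𝒮 W hW L P E →
    ∀ (x : W), x ∈ Scheme.hsStratum W N ν → ∀ (C : W.IdealSheafData), M W E N ν x C →
      IdealSheafData.IsPermissible C ∧ (C.support : Set W) ⊆ Scheme.hsStratum W N ν ∧
        ((Scheme.hsStratum W N ν).Nonempty → (C.support : Set W).Nonempty)

variable {M M' : CentreMenu.{u}} {N : ℕ} {ν : ℕ → ℕ} {σ τ : StrategyE.{u}} {𝒮 𝒯 : StateScopeE.{u}}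

/-- Discipline is monotone in the menu. [folklore] -/
theorem StrategyE.IsDisciplinedBy.mono (h : σ.IsDisciplinedBy M N ν) (hM : ∀ W E x C, M W E N ν x C → M' W E N ν x C) :
    σ.IsDisciplinedBy M' N ν := by
  intro W hW L P E C P' hstep
  obtain ⟨x, hx, hC⟩ := h W hW L P E C P' hstep
  exact ⟨x, hx, hM W E x C hC⟩

/-- Pure discipline is discipline over any fallback. [folklore] -/
theorem StrategyE.IsDisciplinedBy.over (h : σ.IsDisciplinedBy M N ν) (τ : StrategyE.{u}) : StrategyE.IsDisciplinedByOver M N ν τ σ :=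
  fun W hW L P E C P' hstep => Or.inl (h W hW L P E C P' hstep)

/-- A sub-strategy of the fallback is disciplined over it. [folklore] -/
theorem StrategyE.isDisciplinedByOver_of_step_imp (h : ∀ W hW L P E C P', σ.step W hW N ν L P E C P' → τ.step W hW N ν L P E C P') :
    StrategyE.IsDisciplinedByOver M N ν τ σ :=
  fun W hW L P E C P' hstep => Or.inr (h W hW L P E C P' hstep)

/-- `MenuClauseA` is antitone in the menu and in the scope. [folklore] -/
theorem MenuClauseA.mono (h : MenuClauseA M' N ν 𝒮) (hM : ∀ W E x C, M W E N ν x C → M' W E N ν x C)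
    (h𝒯 : ∀ W hW L P E, 𝒯 W hW L P E → 𝒮 W hW L P E) : MenuClauseA M N ν 𝒯 :=
  fun W hW L P E hT x hx C hC => h W hW L P E (h𝒯 W hW L P E hT) x hx C (hM W E x C hC)

/-- **CLAUSE (a) FOR A DISCIPLINED STRATEGY**: at a state of the scope, every step an `M`-disciplined `σ` allows satisfies clause (a), by `MenuClauseA`.
[cite: CossartJannsenSaito2020, Def. 3.1, Rem. 6.29 (1)] -/
theorem StrategyE.IsDisciplinedBy.clauseA (hσ : σ.IsDisciplinedBy M N ν) (hM : MenuClauseA M N ν 𝒮)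
    {W : Scheme.{u}} {hW : IsLocallyNoetherian W} {L : Labelling W} {P : Option (Pending W)} {E : Boundary W} (hS : 𝒮 W hW L P E)
    {C : W.IdealSheafData} {P' : Option (Pending (blowup C))} (hstep : σ.step W hW N ν L P E C P') :
    IdealSheafData.IsPermissible C ∧ (C.support : Set W) ⊆ Scheme.hsStratum W N ν ∧
      ((Scheme.hsStratum W N ν).Nonempty → (C.support : Set W).Nonempty) := by
  obtain ⟨x, hx, hC⟩ := hσ W hW L P E C P' hstep
  exact hM W hW L P E hS x hx C hC

/-- **SCOPED ADMISSIBILITY OF A DISCIPLINED STRATEGY**: disciplined by `M` + `MenuClauseA M` on the scope + TOTAL on the scope (the design's service rule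
names a step while the stratum is non-empty) ⇒ `IsAdmissibleStrategyOnE 𝒮 N ν σ`. [cite: CossartJannsenSaito2020, Def. 3.1, Rem. 6.29 (1)] -/
theorem isAdmissibleStrategyOnE_of_disciplinedBy (hσ : σ.IsDisciplinedBy M N ν) (hM : MenuClauseA M N ν 𝒮)
    (htotal : ∀ (W : Scheme.{u}) (hW : IsLocallyNoetherian W) (L : Labelling W) (P : Option (Pending W)) (E : Boundary W), 𝒮 W hW L P E →
      (Scheme.hsStratum W N ν).Nonempty → ∃ (C : W.IdealSheafData) (P' : Option (Pending (blowup C))), σ.step W hW N ν L P E C P') :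
    IsAdmissibleStrategyOnE 𝒮 N ν σ :=
  fun W hW L P E hS => ⟨fun _ _ hstep => hσ.clauseA hM hS hstep, htotal W hW L P E hS⟩

/-- **SCOPED ADMISSIBILITY OF A HYBRID**: disciplined by `M` over a fallback `τ` whose own steps satisfy clause (a) on the scope (the cell's centre package for
`σ_CJS`, res-type-040's Ω⁺ package, …) + `MenuClauseA M` + totality on the scope ⇒ `IsAdmissibleStrategyOnE 𝒮 N ν σ`.
[cite: CossartJannsenSaito2020, Def. 3.1, Rem. 6.29 (1)] -/
theorem isAdmissibleStrategyOnE_of_disciplinedByOver (hσ : StrategyE.IsDisciplinedByOver M N ν τ σ) (hM : MenuClauseA M N ν 𝒮)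
    (hτ : ∀ (W : Scheme.{u}) (hW : IsLocallyNoetherian W) (L : Labelling W) (P : Option (Pending W)) (E : Boundary W), 𝒮 W hW L P E →
      ∀ (C : W.IdealSheafData) (P' : Option (Pending (blowup C))), τ.step W hW N ν L P E C P' →
        IdealSheafData.IsPermissible C ∧ (C.support : Set W) ⊆ Scheme.hsStratum W N ν ∧
          ((Scheme.hsStratum W N ν).Nonempty → (C.support : Set W).Nonempty))
    (htotal : ∀ (W : Scheme.{u}) (hW : IsLocallyNoetherian W) (L : Labelling W) (P : Option (Pending W)) (E : Boundary W), 𝒮 W hW L P E →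
      (Scheme.hsStratum W N ν).Nonempty → ∃ (C : W.IdealSheafData) (P' : Option (Pending (blowup C))), σ.step W hW N ν L P E C P') :
    IsAdmissibleStrategyOnE 𝒮 N ν σ := by
  intro W hW L P E hS
  refine ⟨fun C P' hstep => ?_, htotal W hW L P E hS⟩
  rcases hσ W hW L P E C P' hstep with ⟨x, hx, hC⟩ | hτstep
  · exact hM W hW L P E hS x hx C hC
  · exact hτ W hW L P E hS C P' hτstep

/-- [OURS · L1 W4.2] **THE `M`-RESTRICTION of a boundary-reading strategy**: keep exactly the steps whose centre is an `M`-centre at a stratum point (at every level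
and value). Disciplined by construction; agrees with `σ` wherever `σ` was disciplined; functionality preserved. NOT a statement of the manuscript. [folklore] -/
def StrategyE.restrictBy (M : CentreMenu.{u}) (σ : StrategyE.{u}) : StrategyE.{u} :=
  ⟨fun W hW N ν L P E C P' => σ.step W hW N ν L P E C P' ∧ ∃ x ∈ Scheme.hsStratum W N ν, M W E N ν x C⟩

/-- The restriction is disciplined. [folklore] -/
theorem StrategyE.isDisciplinedBy_restrictBy (M : CentreMenu.{u}) (N : ℕ) (ν : ℕ → ℕ) (σ : StrategyE.{u}) :
    (σ.restrictBy M).IsDisciplinedBy M N ν :=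
  fun _ _ _ _ _ _ _ h => h.2

/-- The restriction only removes steps. [folklore] -/
theorem StrategyE.restrictBy_step_imp {W : Scheme.{u}} {hW : IsLocallyNoetherian W} {L : Labelling W} {P : Option (Pending W)} {E : Boundary W}
    {C : W.IdealSheafData} {P' : Option (Pending (blowup C))} (h : (σ.restrictBy M).step W hW N ν L P E C P') :
    σ.step W hW N ν L P E C P' :=
  h.1

/-- A disciplined strategy is its own restriction at `(N, ν)` (pointwise `Iff`). [folklore] -/
theorem StrategyE.IsDisciplinedBy.restrictBy_step_iff (hσ : σ.IsDisciplinedBy M N ν) {W : Scheme.{u}} {hW : IsLocallyNoetherian W} {L : Labelling W}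
    {P : Option (Pending W)} {E : Boundary W} {C : W.IdealSheafData} {P' : Option (Pending (blowup C))} :
    (σ.restrictBy M).step W hW N ν L P E C P' ↔ σ.step W hW N ν L P E C P' :=
  ⟨fun h => h.1, fun h => ⟨h, hσ W hW L P E C P' h⟩⟩

/-- Functionality passes to the restriction (fewer steps). [folklore] -/
theorem StrategyE.IsFunctional.restrictBy (h : σ.IsFunctional N ν) (M : CentreMenu.{u}) : (σ.restrictBy M).IsFunctional N ν :=
  fun W hW L P E =>
    ⟨fun C₁ C₂ P₁ P₂ h₁ h₂ => (h W hW L P E).1 C₁ C₂ P₁ P₂ h₁.1 h₂.1,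
      fun C P₁ P₂ h₁ h₂ => (h W hW L P E).2 C P₁ P₂ h₁.1 h₂.1⟩


/-! ## §2. The POLICY-PARAMETRIC HYBRID: a designed policy `π` over a fallback `τ` (RULING v3.14-13 (DA)/(DP)) -/

/-- [OURS · L1 W4.2] **THE HYBRID OF A POLICY `π` OVER A FALLBACK `τ`**: at a state where the policy `π` (any boundary-reading strategy — e.g. one built from a
corner policy reading the Plus menu, (CX)'s `exists_cornerOracle_of_initialSolvable` read scheme-side) proposes some step, the hybrid allows exactly
`π`'s steps; where `π` proposes nothing, it allows the fallback `τ`'s steps (σ_CJS with boundary, Ω / Ω⁺E, …). NOT a statement of the manuscript. [folklore] -/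
def StrategyE.hybrid (π τ : StrategyE.{u}) : StrategyE.{u} :=
  ⟨fun W hW N ν L P E C P' =>
    π.step W hW N ν L P E C P' ∨
      ((¬ ∃ (C₀ : W.IdealSheafData) (P₀ : Option (Pending (blowup C₀))), π.step W hW N ν L P E C₀ P₀) ∧ τ.step W hW N ν L P E C P')⟩

variable {π : StrategyE.{u}}

/-- A policy step is a hybrid step. [folklore] -/
theorem StrategyE.hybrid_step_of_policy {W : Scheme.{u}} {hW : IsLocallyNoetherian W} {L : Labelling W} {P : Option (Pending W)} {E : Boundary W}
    {C : W.IdealSheafData} {P' : Option (Pending (blowup C))} (h : π.step W hW N ν L P E C P') : (π.hybrid τ).step W hW N ν L P E C P' :=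
  Or.inl h

/-- Where the policy is silent, a fallback step is a hybrid step. [folklore] -/
theorem StrategyE.hybrid_step_of_fallback {W : Scheme.{u}} {hW : IsLocallyNoetherian W} {L : Labelling W} {P : Option (Pending W)} {E : Boundary W}
    {C : W.IdealSheafData} {P' : Option (Pending (blowup C))}
    (hπ : ¬ ∃ (C₀ : W.IdealSheafData) (P₀ : Option (Pending (blowup C₀))), π.step W hW N ν L P E C₀ P₀) (h : τ.step W hW N ν L P E C P') :
    (π.hybrid τ).step W hW N ν L P E C P' :=
  Or.inr ⟨hπ, h⟩

/-- Every hybrid step is a policy step or a fallback step. [folklore] -/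
theorem StrategyE.hybrid_step_cases {W : Scheme.{u}} {hW : IsLocallyNoetherian W} {L : Labelling W} {P : Option (Pending W)} {E : Boundary W}
    {C : W.IdealSheafData} {P' : Option (Pending (blowup C))} (h : (π.hybrid τ).step W hW N ν L P E C P') :
    π.step W hW N ν L P E C P' ∨ τ.step W hW N ν L P E C P' :=
  h.imp id And.right

/-- **A hybrid of an `M`-disciplined policy is `M`-disciplined over its fallback.** [folklore] -/
theorem StrategyE.IsDisciplinedBy.hybrid (hπ : π.IsDisciplinedBy M N ν) (τ : StrategyE.{u}) :
    StrategyE.IsDisciplinedByOver M N ν τ (π.hybrid τ) :=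
  fun W hW L P E C P' h => (StrategyE.hybrid_step_cases h).imp (hπ W hW L P E C P') id

/-- **The hybrid is TOTAL on a scope as soon as the fallback is** (where the policy is silent the fallback speaks; where it speaks, it speaks). [folklore] -/
theorem StrategyE.hybrid_total
    (hτ : ∀ (W : Scheme.{u}) (hW : IsLocallyNoetherian W) (L : Labelling W) (P : Option (Pending W)) (E : Boundary W), 𝒮 W hW L P E →
      (Scheme.hsStratum W N ν).Nonempty → ∃ (C : W.IdealSheafData) (P' : Option (Pending (blowup C))), τ.step W hW N ν L P E C P') :
    ∀ (W : Scheme.{u}) (hW : IsLocallyNoetherian W) (L : Labelling W) (P : Option (Pending W)) (E : Boundary W), 𝒮 W hW L P E →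
      (Scheme.hsStratum W N ν).Nonempty → ∃ (C : W.IdealSheafData) (P' : Option (Pending (blowup C))), (π.hybrid τ).step W hW N ν L P E C P' := by
  intro W hW L P E hS hne
  by_cases hπ : ∃ (C₀ : W.IdealSheafData) (P₀ : Option (Pending (blowup C₀))), π.step W hW N ν L P E C₀ P₀
  · obtain ⟨C₀, P₀, h⟩ := hπ
    exact ⟨C₀, P₀, Or.inl h⟩
  · obtain ⟨C, P', h⟩ := hτ W hW L P E hS hne
    exact ⟨C, P', Or.inr ⟨hπ, h⟩⟩

/-- **The hybrid of FUNCTIONAL strategies is functional** (at each state all hybrid steps come from one of the two). [folklore] -/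
theorem StrategyE.IsFunctional.hybrid (hπ : π.IsFunctional N ν) (hτ : τ.IsFunctional N ν) : (π.hybrid τ).IsFunctional N ν := by
  intro W hW L P E
  refine ⟨fun C₁ C₂ P₁ P₂ h₁ h₂ => ?_, fun C P₁ P₂ h₁ h₂ => ?_⟩
  · rcases h₁ with h₁ | ⟨hn₁, h₁⟩ <;> rcases h₂ with h₂ | ⟨hn₂, h₂⟩
    · exact (hπ W hW L P E).1 C₁ C₂ P₁ P₂ h₁ h₂
    · exact absurd ⟨C₁, P₁, h₁⟩ hn₂
    · exact absurd ⟨C₂, P₂, h₂⟩ hn₁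
    · exact (hτ W hW L P E).1 C₁ C₂ P₁ P₂ h₁ h₂
  · rcases h₁ with h₁ | ⟨hn₁, h₁⟩ <;> rcases h₂ with h₂ | ⟨hn₂, h₂⟩
    · exact (hπ W hW L P E).2 C P₁ P₂ h₁ h₂
    · exact absurd ⟨C, P₁, h₁⟩ hn₂
    · exact absurd ⟨C, P₂, h₂⟩ hn₁
    · exact (hτ W hW L P E).2 C P₁ P₂ h₁ h₂

/-- **SCOPED ADMISSIBILITY OF THE HYBRID** of an `M`-disciplined policy over a fallback whose steps satisfy clause (a) and which is total on the scope:
`IsAdmissibleStrategyOnE 𝒮 N ν (π.hybrid τ)` — the plug for ANY corner policy (RULING (DA)). [cite: CossartJannsenSaito2020, Def. 3.1, Rem. 6.29 (1)] -/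
theorem isAdmissibleStrategyOnE_hybrid (hπ : π.IsDisciplinedBy M N ν) (hM : MenuClauseA M N ν 𝒮)
    (hτa : ∀ (W : Scheme.{u}) (hW : IsLocallyNoetherian W) (L : Labelling W) (P : Option (Pending W)) (E : Boundary W), 𝒮 W hW L P E →
      ∀ (C : W.IdealSheafData) (P' : Option (Pending (blowup C))), τ.step W hW N ν L P E C P' →
        IdealSheafData.IsPermissible C ∧ (C.support : Set W) ⊆ Scheme.hsStratum W N ν ∧
          ((Scheme.hsStratum W N ν).Nonempty → (C.support : Set W).Nonempty))
    (hτt : ∀ (W : Scheme.{u}) (hW : IsLocallyNoetherian W) (L : Labelling W) (P : Option (Pending W)) (E : Boundary W), 𝒮 W hW L P E →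
      (Scheme.hsStratum W N ν).Nonempty → ∃ (C : W.IdealSheafData) (P' : Option (Pending (blowup C))), τ.step W hW N ν L P E C P') :
    IsAdmissibleStrategyOnE 𝒮 N ν (π.hybrid τ) :=
  isAdmissibleStrategyOnE_of_disciplinedByOver (hπ.hybrid τ) hM hτa (StrategyE.hybrid_total hτt)

end Summit.ResolutionOfSingularities.ResolutionOfSingularities.Theorems.SigmaMaxModificationsCorridor3.Sigma

end
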